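/-
Copyright (c) 2026. All rights reserved.
Released under Apache 2.0 license as described in the file LICENSE.
Authors: abc-iut cell, wave-4 seat abc-iut-w4-d064 (proof-only; support for [SemiAnbd] Cor 3.9 step R3).
-/
import Literature.AnabelianGeometry.SemiGraphs.TemperedEdgeInVerticialProofs
import Literature.AnabelianGeometry.SemiGraphs.TemperedFunctorialityProofs
import HarnessLib

/-!
# [SemiAnbd] §3: the gluing of a chart along a branch is translation by one element of `π₁^temp(G)`

Mochizuki, *Semi-graphs of anabelioids*, Publ. RIMS **42** (2006) [MochizukiSemiAnbd2006], §3 p. 36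
(the data `{S_v, φ_e}` of `B^cov(G)`), Prop. 3.2 p. 35, Thm. 3.7 (i)/(iii) pp. 40–41.  Let `c` be a
tempered fundamental group of `G` (a chart `B^temp(G) ≌ B^temp(Π)`), `b` a branch of `e` abutting to
`v`, and `ψ_e : Π_e → Π`, `ψ_v : Π_v → Π` edge-like / verticial homomorphisms with their defining
isomorphisms `iE : (Y ↦ (c⁻¹Y)_e) ≅ B^temp(ψ_e)`, `iV : (Y ↦ (c⁻¹Y)_v) ≅ B^temp(ψ_v)`.  For an edge `f` with `edgeOf b = f` (re-indexing as in `glueNatIsoAt`), transporting the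
gluings `(c⁻¹Y)_e ≅ b^*(c⁻¹Y)_v` along `iE`, `iV` gives a natural isomorphism
`B^temp(ψ_e) ≅ B^temp(ψ_v ∘ b_*)`, which by [SemiAnbd] Prop. 3.2 (the tree's
`BTemp.exists_conj_of_natTrans`) IS the action of ONE element `λ_b ∈ Π` with
`λ_b · ψ_e(a) · λ_b⁻¹ = ψ_v(b_* a)`: `exists_glueElement` records `λ_b` TOGETHER WITH the pointwise
formula `iV(glue(iE⁻¹ y)) = λ_b · y` for every `Y ∈ B^temp(Π)` and `y ∈ Y` — the "normal form" of
the chart's gluings used in the proof of Cor. 3.9 (step R3: comparing `c_G⁻¹ B^temp(φ)X` with the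
pull-back of `c_H⁻¹ X` branch by branch).  PROOF-ONLY; no definitions; nothing here bears on [IUTchIII] Cor. 3.12.
-/

namespace Literature.AnabelianGeometry.SemiGraphs

open CategoryTheory Topology

universe u

namespace ProfiniteSemiGraph

namespace TemperedPiChart

variable {𝒢 : ProfiniteSemiGraph.{u}} (c : TemperedPiChart 𝒢) {b : 𝒢.graph.Branch}
  {v : 𝒢.graph.Vertex} (h : 𝒢.graph.abuts b = some v) {f : 𝒢.graph.Edge}
  (q : 𝒢.graph.edgeOf b = f)
  {ψe : 𝒢.Ge f →ₜ* c.G} {ψv : 𝒢.Gv v →ₜ* c.G}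
  (iE : c.equiv.inverse ⋙ ObjectProperty.ι _ ⋙ restrictE 𝒢 f ≅ BTemp.res ψe)
  (iV : c.equiv.inverse ⋙ ObjectProperty.ι _ ⋙ restrictV 𝒢 v ≅ BTemp.res ψv)

/-- **The gluing element `λ_b` of the chart**: there is `λ_b ∈ Π` conjugating `ψ_e` into
`ψ_v ∘ b_*` AND acting as the transported gluing on every `Y ∈ B^temp(Π)`:
`iV(glue_b(iE⁻¹ y)) = λ_b · y`.  (The transported gluing
`B^temp(ψ_e) ≅ (Y ↦ (c⁻¹Y)_e) ≅ (Y ↦ b^*(c⁻¹Y)_v) ≅ B^temp(ψ_v) ⋙ B^temp(b_*) = B^temp(ψ_v ∘ b_*)` is a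
natural transformation between pull-back functors, hence — [SemiAnbd] Prop. 3.2, the tree's
`BTemp.exists_conj_of_natTrans` — the action of one element.) [cite: MochizukiSemiAnbd2006, Prop 3.2 p.35] -/
theorem exists_glueElement :
    ∃ lam : c.G, (∀ a, lam * ψe a * lam⁻¹ = ψv (𝒢.brHomAt b v h f q a)) ∧
      ∀ (Y : BTemp c.G) (y : Y.obj.V),
        (iV.hom.app Y).hom.hom
            (((c.equiv.inverse.obj Y).obj.glue b v h).hom.hom.hom (q ▸ (iE.inv.app Y).hom.hom y)) =
          Y.obj.ρ lam y := by
  -- the transported gluing, as a natural isomorphism `B^temp(ψ_e) ≅ B^temp(ψ_v ∘ b_*)`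
  let glueTransport : BTemp.res ψe ≅ BTemp.res (ψv.comp (𝒢.brHomAt b v h f q)) :=
    iE.symm ≪≫
      (Functor.isoWhiskerLeft c.equiv.inverse
          (Functor.isoWhiskerLeft (ObjectProperty.ι _) (𝒢.glueNatIsoAt b v h f q)) ≪≫
        Functor.isoWhiskerLeft c.equiv.inverse (Functor.associator _ _ _).symm ≪≫
          (Functor.associator _ _ _).symm) ≪≫
      Functor.isoWhiskerRight iV (BTemp.res (𝒢.brHomAt b v h f q)) ≪≫
      BTemp.resComp ψv (𝒢.brHomAt b v h f q)
  obtain ⟨lam, hlam, happ⟩ := BTemp.exists_conj_of_natTrans c.isTempered ψe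
    (ψv.comp (𝒢.brHomAt b v h f q)) glueTransport.hom
  refine ⟨lam, hlam, fun Y y => ?_⟩
  rw [← happ Y y]
  subst q
  rfl

end TemperedPiChart

end ProfiniteSemiGraph

end Literature.AnabelianGeometry.SemiGraphs
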